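import Mathlib
import HarnessLib

/-!
# Fejér pair sums: `Σ_{i,j<N} g(j − i) = N g(0) + Σ_{t=1}^{N−1} (N − t)(g(t) + g(−t))`, the limit `(1/N) Σ_{i,j<N} g(j − i) → Σ_{m∈ℤ} g(m)`, and a Cesàro lemma for double sums of tails

HONEST FRAMING: exact (Metropolis-corrected) sampling algorithms for lattice gauge theory;
figures of merit are autocorrelation/cost numbers at stated couplings and volumes; no
continuum-physics claim.

Venture `LatticeQCDFlow` (cell pub-lqcd), sub-topic `Scoring`; FANOUT row 16 (`su2-base`), GEN-6.
NEW WORK of the cell (elementary real analysis over Mathlib: Tannery's theorem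
`tendsto_tsum_of_dominated_convergence`, `Filter.Tendsto.cesaro`, `tendsto_sum_nat_add`); nothing
is cited as a fact.  Second file of the ERROR-OF-THE-ERROR packet (the statistical error of the
windowed `τ̂_int`, row 16 acceptance (d)); its two analytic engines, used twice each downstream —
once with `N` = the run length (Bartlett's formula, `BartlettKernel.lean`) and once with `N` = the
window `W` (the Madras–Sokal asymptote `4 W τ_int²`, `MadrasSokalErrorFormula.lean`).

The tree has the EVEN case of the pair count (`Literature…IntegratedAutocorrelationTime.sum_sum_dist`,
`Scoring/VarianceOfTheMean`: `Σ_{i,j<N} C|i−j| = N C 0 + 2 Σ (N−t) C t`) and the limit under a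
first-moment condition (`VarianceOfTheMean.abs_tauInt_sub_tauIntN_le`, `|τ_int − τ_N| ≤ M/N` with
`M = Σ t|ρ t|`).  Bartlett's summand `g_{s,t}(m) = c(m)c(m+t−s) + c(m+t)c(m−s)` is NOT even in `m`
(`g_{s,t}(−m) = g_{t,s}(m)`), and the Madras–Sokal limit should not need a moment condition, so:

* **`sum_sum_int_sub`** — for every `g : ℤ → ℝ` and `N`:
  `Σ_{i<N} Σ_{j<N} g(j − i) = N·g 0 + Σ_{t<N} (N − (t+1))·(g(t+1) + g(−(t+1)))` (induction on `N`;
  the `t + 1 = N` term has weight `0`);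
  `sum_sum_int_sub_div` — `(1/N)·Σ_{i,j<N} g(j − i) = g 0 + Σ_{t<N} (1 − (t+1)/N)(g(t+1) + g(−(t+1)))`.
* `tsum_int_eq_zero_add_tsum_nat` — `Σ_{m∈ℤ} g m = g 0 + Σ_{t≥0} (g(t+1) + g(−(t+1)))` for summable `g`.
* **`tendsto_sum_sum_int_sub_div`** — if `g` is summable over `ℤ` then
  `(1/N)·Σ_{i,j<N} g(j − i) → Σ_{m∈ℤ} g m` as `N → ∞` (Tannery: the Fejér weights `1 − (t+1)/N ∈ [0,1]`
  tend to `1`; NO moment condition);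
  `abs_sum_sum_int_sub_div_sub_tsum_le` — with a first moment `M₁ = Σ_{t≥0} (t+1)(|g(t+1)| + |g(−(t+1))|)
  < ∞` the error is `≤ M₁/N` for every `N ≥ 1` (the signed analogue of `abs_tauInt_sub_tauIntN_le`).
* **`tendsto_sum_sum_add_div`** — for a summable `u : ℕ → ℝ` and any offset `k`,
  `(1/W)·Σ_{s<W} Σ_{t<W} u(s + t + k) → 0` as `W → ∞`: the double sum is at most `Σ_{s<W} T(s)` with
  the TAILS `T(s) = Σ_{t} |u(t + s + k)| → 0`, and Cesàro means of a null sequence are null.  (This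
  kills the 'exchange' term `Σ_{s,t≤W} K(s+t)` of the Madras–Sokal window sum at the scale `W`.)

NOT here: anything probabilistic (the consumers are `BartlettKernel.lean` and
`MadrasSokalErrorFormula.lean`).
-/

noncomputable section

open Finset Filter Topology

namespace Summit.Ventures.LatticeQCDFlow.Scoring

/-! ## The signed pair count -/

/-- Reindexing: `Σ_{i<N} g(N − i) = Σ_{t<N} g(t + 1)`. -/
theorem sum_range_int_sub_left (g : ℤ → ℝ) (N : ℕ) :
    ∑ i ∈ range N, g ((N : ℤ) - i) = ∑ t ∈ range N, g ((t : ℤ) + 1) := by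
  rw [← sum_range_reflect (fun t : ℕ => g ((t : ℤ) + 1)) N]
  refine sum_congr rfl fun i hi => ?_
  have hi' := mem_range.mp hi
  exact congrArg g (by omega)

/-- Reindexing: `Σ_{j<N} g(j − N) = Σ_{t<N} g(−(t + 1))`. -/
theorem sum_range_int_sub_right (g : ℤ → ℝ) (N : ℕ) :
    ∑ j ∈ range N, g ((j : ℤ) - N) = ∑ t ∈ range N, g (-((t : ℤ) + 1)) := by
  rw [← sum_range_reflect (fun t : ℕ => g (-((t : ℤ) + 1))) N]
  refine sum_congr rfl fun j hj => ?_
  have hj' := mem_range.mp hj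
  exact congrArg g (by omega)

/-- **The signed pair count (Fejér weights).**  For every `g : ℤ → ℝ`,
`Σ_{i<N} Σ_{j<N} g(j − i) = N·g 0 + Σ_{t<N} (N − (t+1))·(g(t+1) + g(−(t+1)))`: the lag `m = j − i`
occurs `N − |m|` times in the square (the `t + 1 = N` term carries weight `0`). -/
theorem sum_sum_int_sub (g : ℤ → ℝ) : ∀ N : ℕ,
    ∑ i ∈ range N, ∑ j ∈ range N, g ((j : ℤ) - i)
      = N * g 0 + ∑ t ∈ range N, ((N : ℝ) - (t + 1)) * (g ((t : ℤ) + 1) + g (-((t : ℤ) + 1)))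
  | 0 => by simp
  | N + 1 => by
    simp only [sum_range_succ, sum_add_distrib]
    rw [sum_sum_int_sub g N, sum_range_int_sub_left, sum_range_int_sub_right, sub_self]
    push_cast
    have aux : ∑ t ∈ range N, ((N : ℝ) + 1 - ((t : ℝ) + 1)) * (g ((t : ℤ) + 1) + g (-((t : ℤ) + 1)))
        = ∑ t ∈ range N, ((N : ℝ) - ((t : ℝ) + 1)) * (g ((t : ℤ) + 1) + g (-((t : ℤ) + 1)))
          + (∑ t ∈ range N, g ((t : ℤ) + 1) + ∑ t ∈ range N, g (-((t : ℤ) + 1))) := by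
      rw [← sum_add_distrib, ← sum_add_distrib]
      exact sum_congr rfl fun t _ => by ring
    rw [aux]
    ring

/-- The normalised pair count: for `N ≥ 1`,
`(1/N)·Σ_{i,j<N} g(j − i) = g 0 + Σ_{t<N} (1 − (t+1)/N)·(g(t+1) + g(−(t+1)))`. -/
theorem sum_sum_int_sub_div (g : ℤ → ℝ) {N : ℕ} (hN : N ≠ 0) :
    (∑ i ∈ range N, ∑ j ∈ range N, g ((j : ℤ) - i)) / N
      = g 0 + ∑ t ∈ range N, (1 - ((t : ℝ) + 1) / N) * (g ((t : ℤ) + 1) + g (-((t : ℤ) + 1))) := by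
  have hN' : (N : ℝ) ≠ 0 := Nat.cast_ne_zero.mpr hN
  rw [sum_sum_int_sub, add_div, mul_div_cancel_left₀ _ hN', sum_div]
  congr 1
  refine sum_congr rfl fun t _ => ?_
  field_simp

/-! ## The limit `(1/N) Σ_{i,j<N} g(j − i) → Σ_ℤ g` -/

/-- The non-negative half of a summable `ℤ`-sequence is summable. -/
theorem summable_nat_of_summable_int {g : ℤ → ℝ} (hg : Summable g) :
    Summable fun n : ℕ => g n :=
  hg.comp_injective Nat.cast_injective

/-- The shifted non-negative half `t ↦ g(t+1)` of a summable `ℤ`-sequence is summable. -/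
theorem summable_nat_succ_of_summable_int {g : ℤ → ℝ} (hg : Summable g) :
    Summable fun t : ℕ => g ((t : ℤ) + 1) :=
  ((summable_nat_add_iff 1).mpr (summable_nat_of_summable_int hg)).congr fun t => by push_cast; ring_nf

/-- The negative half `t ↦ g(−(t+1))` of a summable `ℤ`-sequence is summable. -/
theorem summable_negSucc_of_summable_int {g : ℤ → ℝ} (hg : Summable g) :
    Summable fun t : ℕ => g (-((t : ℤ) + 1)) :=
  hg.comp_injective (i := fun n : ℕ => -((n : ℤ) + 1)) fun a b h => by simpa using h

/-- The folded sequence `t ↦ g(t+1) + g(−(t+1))` is summable when `g` is summable over `ℤ`. -/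
theorem summable_fold_of_summable_int {g : ℤ → ℝ} (hg : Summable g) :
    Summable fun t : ℕ => g ((t : ℤ) + 1) + g (-((t : ℤ) + 1)) :=
  (summable_nat_succ_of_summable_int hg).add (summable_negSucc_of_summable_int hg)

/-- `Σ_{m∈ℤ} g m = g 0 + Σ_{t≥0} (g(t+1) + g(−(t+1)))` for summable `g`. -/
theorem tsum_int_eq_zero_add_tsum_nat {g : ℤ → ℝ} (hg : Summable g) :
    ∑' m, g m = g 0 + ∑' t : ℕ, (g ((t : ℤ) + 1) + g (-((t : ℤ) + 1))) := by
  have hn := summable_nat_of_summable_int hg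
  have hneg := summable_negSucc_of_summable_int hg
  have h1 := summable_nat_succ_of_summable_int hg
  rw [tsum_of_nat_of_neg_add_one hn hneg, hn.tsum_eq_zero_add, h1.tsum_add hneg]
  push_cast
  ring

/-- **The Fejér limit.**  If `g : ℤ → ℝ` is summable then `(1/N)·Σ_{i<N} Σ_{j<N} g(j − i) → Σ_{m∈ℤ} g m`
as `N → ∞` — no moment condition (Tannery's theorem: the weights `1 − (t+1)/N ∈ [0, 1]` tend to `1`). -/
theorem tendsto_sum_sum_int_sub_div {g : ℤ → ℝ} (hg : Summable g) :
    Tendsto (fun N : ℕ => (∑ i ∈ range N, ∑ j ∈ range N, g ((j : ℤ) - i)) / N)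
      atTop (𝓝 (∑' m, g m)) := by
  set h : ℕ → ℝ := fun t => g ((t : ℤ) + 1) + g (-((t : ℤ) + 1)) with hh_def
  have hh : Summable h := summable_fold_of_summable_int hg
  -- the Fejér-weighted partial sums as a `tsum` of a truncated sequence
  set f : ℕ → ℕ → ℝ := fun N t => if t < N then (1 - ((t : ℝ) + 1) / N) * h t else 0 with hf_def
  have hfsum : ∀ N : ℕ, ∑ t ∈ range N, (1 - ((t : ℝ) + 1) / N) * h t = ∑' t, f N t := by
    intro N
    rw [tsum_eq_sum (s := range N)]
    · exact sum_congr rfl fun t ht => by simp [hf_def, mem_range.mp ht]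
    · intro t ht
      simp [hf_def, mem_range.not.mp ht |> not_lt.mp]
  have key : Tendsto (fun N : ℕ => ∑' t, f N t) atTop (𝓝 (∑' t, h t)) := by
    refine tendsto_tsum_of_dominated_convergence (bound := fun t => ‖h t‖) hh.norm ?_ ?_
    · intro t
      have hlim : Tendsto (fun N : ℕ => (1 - ((t : ℝ) + 1) / N) * h t) atTop (𝓝 ((1 - 0) * h t)) :=
        (tendsto_const_nhds.sub (tendsto_const_div_atTop_nhds_zero_nat _)).mul tendsto_const_nhds
      rw [sub_zero, one_mul] at hlim
      refine hlim.congr' ?_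
      filter_upwards [eventually_gt_atTop t] with N hN
      simp [hf_def, hN]
    · filter_upwards [eventually_gt_atTop 0] with N hN
      intro t
      by_cases ht : t < N
      · have hle : ((t : ℝ) + 1) / N ≤ 1 := by
          rw [div_le_one (by exact_mod_cast hN)]
          exact_mod_cast ht
        have hge : 0 ≤ ((t : ℝ) + 1) / N := by positivity
        simp only [hf_def, if_pos ht, norm_mul, Real.norm_eq_abs]
        rw [abs_of_nonneg (by linarith)]
        exact mul_le_of_le_one_left (abs_nonneg _) (by linarith)
      · simp [hf_def, ht]
  rw [tsum_int_eq_zero_add_tsum_nat hg]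
  refine ((tendsto_const_nhds (x := g 0)).add key).congr' ?_
  filter_upwards [eventually_ne_atTop 0] with N hN
  rw [sum_sum_int_sub_div g hN, hfsum N]

/-- **The rate under a first moment.**  If `M₁ = Σ_{t≥0} (t+1)(|g(t+1)| + |g(−(t+1))|) < ∞` then
`|(1/N)·Σ_{i,j<N} g(j − i) − Σ_{m∈ℤ} g m| ≤ M₁/N` for every `N ≥ 1` (the signed analogue of
`VarianceOfTheMean.abs_tauInt_sub_tauIntN_le`). -/
theorem abs_sum_sum_int_sub_div_sub_tsum_le {g : ℤ → ℝ} (hg : Summable g)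
    (hM : Summable fun t : ℕ => ((t : ℝ) + 1) * (|g ((t : ℤ) + 1)| + |g (-((t : ℤ) + 1))|))
    {N : ℕ} (hN : N ≠ 0) :
    |(∑ i ∈ range N, ∑ j ∈ range N, g ((j : ℤ) - i)) / N - ∑' m, g m|
      ≤ (∑' t : ℕ, ((t : ℝ) + 1) * (|g ((t : ℤ) + 1)| + |g (-((t : ℤ) + 1))|)) / N := by
  have hN' : (0 : ℝ) < N := by exact_mod_cast Nat.pos_of_ne_zero hN
  set h : ℕ → ℝ := fun t => g ((t : ℤ) + 1) + g (-((t : ℤ) + 1)) with hh_def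
  set a : ℕ → ℝ := fun t => |g ((t : ℤ) + 1)| + |g (-((t : ℤ) + 1))| with ha_def
  set w : ℕ → ℝ := fun t => ((t : ℝ) + 1) * a t with hw_def
  have hh : Summable h := summable_fold_of_summable_int hg
  have hw : Summable w := hM
  have hha : ∀ t, |h t| ≤ a t := fun t => abs_add_le _ _
  have ha0 : ∀ t, 0 ≤ a t := fun t => by positivity
  -- the difference = −(window defect) − (tail)
  have hdiff : (∑ i ∈ range N, ∑ j ∈ range N, g ((j : ℤ) - i)) / N - ∑' m, g m
      = -(∑ t ∈ range N, ((t : ℝ) + 1) / N * h t) - ∑' t, h (t + N) := by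
    rw [sum_sum_int_sub_div g hN, tsum_int_eq_zero_add_tsum_nat hg, ← hh.sum_add_tsum_nat_add N]
    have : ∑ t ∈ range N, (1 - ((t : ℝ) + 1) / N) * h t
        = ∑ t ∈ range N, h t - ∑ t ∈ range N, ((t : ℝ) + 1) / N * h t := by
      rw [← sum_sub_distrib]
      exact sum_congr rfl fun t _ => by ring
    rw [this]
    ring
  -- the window defect
  have h1 : |∑ t ∈ range N, ((t : ℝ) + 1) / N * h t| ≤ (∑ t ∈ range N, w t) / N := by
    rw [sum_div]
    refine (abs_sum_le_sum_abs _ _).trans (sum_le_sum fun t _ => ?_)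
    rw [abs_mul, abs_of_nonneg (by positivity : (0 : ℝ) ≤ ((t : ℝ) + 1) / N), hw_def]
    simp only
    rw [mul_div_right_comm]
    exact mul_le_mul_of_nonneg_left (hha t) (by positivity)
  -- the tail
  have hs1 : Summable fun t => h (t + N) := (summable_nat_add_iff N).mpr hh
  have hs2 : Summable fun t => w (t + N) := (summable_nat_add_iff N).mpr hw
  have h2 : |∑' t, h (t + N)| ≤ (∑' t, w (t + N)) / N := by
    have hterm : ∀ t, |h (t + N)| ≤ w (t + N) / N := by
      intro t
      refine (hha _).trans ?_
      rw [hw_def]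
      simp only
      rw [le_div_iff₀ hN']
      have : (N : ℝ) ≤ ((t + N : ℕ) : ℝ) + 1 := by
        push_cast
        linarith [(Nat.cast_nonneg t : (0 : ℝ) ≤ t)]
      nlinarith [ha0 (t + N)]
    calc |∑' t, h (t + N)| ≤ ∑' t, |h (t + N)| := by
            have := norm_tsum_le_tsum_norm hs1.norm
            simpa only [Real.norm_eq_abs] using this
      _ ≤ ∑' t, w (t + N) / N := Summable.tsum_le_tsum hterm hs1.abs (hs2.div_const _)
      _ = (∑' t, w (t + N)) / N := tsum_div_const
  -- combine
  rw [hdiff]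
  calc |-(∑ t ∈ range N, ((t : ℝ) + 1) / N * h t) - ∑' t, h (t + N)|
      ≤ |∑ t ∈ range N, ((t : ℝ) + 1) / N * h t| + |∑' t, h (t + N)| := by
        rw [sub_eq_add_neg]
        refine (abs_add_le _ _).trans ?_
        rw [abs_neg, abs_neg]
    _ ≤ (∑ t ∈ range N, w t) / N + (∑' t, w (t + N)) / N := add_le_add h1 h2
    _ = (∑' t, w t) / N := by rw [← add_div, hw.sum_add_tsum_nat_add N]

/-! ## A Cesàro lemma for the exchange term -/

/-- **Double sums of a summable sequence along anti-diagonals are `o(W)`.**  For a summable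
`u : ℕ → ℝ` and any offset `k`, `(1/W)·Σ_{s<W} Σ_{t<W} u(s + t + k) → 0` as `W → ∞`: the double sum
is at most `Σ_{s<W} T(s)` with the tails `T(s) = Σ_t |u(t + (s + k))| → 0`, and Cesàro means of a null
sequence are null (`Filter.Tendsto.cesaro`). -/
theorem tendsto_sum_sum_add_div {u : ℕ → ℝ} (hu : Summable u) (k : ℕ) :
    Tendsto (fun W : ℕ => (∑ s ∈ range W, ∑ t ∈ range W, u (s + t + k)) / W) atTop (𝓝 0) := by
  have hu' : Summable fun n => |u n| := hu.abs
  set T : ℕ → ℝ := fun s => ∑' t, |u (t + (s + k))| with hT_def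
  have hT : Tendsto T atTop (𝓝 0) :=
    (tendsto_sum_nat_add fun n => |u n|).comp (tendsto_add_atTop_nat k)
  have hC : Tendsto (fun W : ℕ => (W : ℝ)⁻¹ * ∑ s ∈ range W, T s) atTop (𝓝 0) := hT.cesaro
  refine squeeze_zero_norm (fun W => ?_) hC
  rw [Real.norm_eq_abs, abs_div, Nat.abs_cast, div_eq_inv_mul]
  refine mul_le_mul_of_nonneg_left ?_ (inv_nonneg.mpr (Nat.cast_nonneg _))
  refine (abs_sum_le_sum_abs _ _).trans (sum_le_sum fun s _ => ?_)
  refine (abs_sum_le_sum_abs _ _).trans ?_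
  have hs : Summable fun t => |u (t + (s + k))| := (summable_nat_add_iff (s + k)).mpr hu'
  have heq : ∀ t, |u (s + t + k)| = |u (t + (s + k))| := fun t => by rw [add_comm s t, add_assoc]
  simp_rw [heq]
  exact hs.sum_le_tsum (range W) fun t _ => abs_nonneg _

end Summit.Ventures.LatticeQCDFlow.Scoring
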